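import Summits.BirchSwinnertonDyer.Uniform.U2.TransportAPlacewise
import Summits.BirchSwinnertonDyer.Rank1Residual.O5.GoodReductionLocalThreeTorsion
import Summits.BirchSwinnertonDyer.Rank1Residual.X11b.LocalTorsionMultiplicative
import Literature.NumberTheory.EllipticCurves.ManinConstantAdditivePrimesProofs
import HarnessLib

/-!
# Track U2, route A (cell `bsd-uniform`, seat u2-p1): the place-wise disjunct (ii)
# «`ℓ ∤ 2∞` and `E(ℚ_ℓ)[2] = 0`» DECIDED at every odd prime — `E(ℚ_ℓ)[2] = 0 ⟺ c_ℓ · #Ẽ_ns(𝔽_ℓ)` odd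

HONEST FRAMING (cell `bsd-uniform`, HOME run/shared/lean/pub/bsd-uniform/, verbatim in every file of
the seat): a RELATIVE ("twist-transport") theorem against NAMED printed facts; converts PAIRS, never
the class X5; books nothing; moves no census number; no per-curve certificate is counted as a
uniform theorem. This file adds NO arithmetic input beyond the tree: it turns the one non-decidable
binder left in `TransportAPlacewise.routeA_placewise_oddTrace` — Mazur–Rubin Lemma 2.10 (ii)
«`E(ℚ_ℓ)[2] = 0`» at a BAD odd prime `ℓ` that does not split in `ℚ(√d)` — into arithmetic of the
base: for a globally minimal `W/ℚ` and ANY odd prime `ℓ` (any reduction type),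
`E(ℚ_ℓ)[2] = 0 ⟺ [E(ℚ_ℓ) : E₁(ℚ_ℓ)] = c_ℓ · #Ẽ_ns(𝔽_ℓ)` is odd `⟺ c_ℓ` odd and the tree's
`frobeniusTrace W ℓ = ℓ + 1 − #Ẽ_ns(𝔽_ℓ)` odd — because `E₁(ℚ_ℓ)` is uniquely `2`-divisible
(Silverman *AEC* IV.2.3 / VII.3.1, tree `forall_nsmul_eq_zero_iff_quotient_formalFiltration`) and
the quotient has order `c_ℓ · #Ẽ_ns(𝔽_ℓ)` (VII.2.1 / VII.6.1, tree
`formalIndex_eq_tamagawa_mul_reductionPointCount`). CONSEQUENCES FOR THE RESIDUE (HOME/RESIDUE.md,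
route A rows): at an ADDITIVE odd `ℓ` (`#Ẽ_ns = ℓ`, `frobeniusTrace = 1`) the disjunct holds iff
`c_ℓ(E)` is ODD — Kodaira types II, II* (`c = 1`), IV, IV* (`c ∈ {1, 3}`), I₀* with `c = 1`: exactly
Kramer–Tunnell 1982 Lemma 6.1's odd-`c` list, reached WITHOUT typing its proof; at a MULTIPLICATIVE
odd `ℓ` (`#Ẽ_ns = ℓ ∓ 1` even) it NEVER holds, so R-A2 (even-`ord` multiplicative primes must split)
is untouched by (ii). RESIDUE R-A1″ after this file: additive odd `ℓ`, non-split in `ℚ(√d)`, with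
`c_ℓ(E)` EVEN (III, III*, I_n* (`n ≥ 1`), I₀* with `c ∈ {2, 4}`).

## Contents
* `forall_two_nsmul_eq_zero_iff_odd_formalIndex` — `ℓ ≠ 2`: `E(ℚ_ℓ)[2] = 0 ⟺ [E(ℚ_ℓ):E₁(ℚ_ℓ)]` odd.
* `forall_two_nsmul_eq_zero_iff_odd_tamagawa_and_odd_frobeniusTrace` — `ℓ ≠ 2`:
  `E(ℚ_ℓ)[2] = 0 ⟺ c_ℓ` odd `∧ frobeniusTrace W ℓ` odd (THE DECIDABLE FORM, any reduction type).
* `not_forall_two_nsmul_eq_zero_of_mult` — at a multiplicative odd `ℓ`, `E(ℚ_ℓ)[2] ≠ 0`.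
* `routeA_placewise_oddTrace_dec` — `routeA_placewise_oddTrace` with disjunct (ii) at the bad odd
  primes in the decidable form `c_ℓ` odd `∧ frobeniusTrace W ℓ` odd.

References: Mazur–Rubin 2010 Lemma 2.10 (ii) [MazurRubin2010]; Silverman *AEC* (2009) IV.2.3,
VII.2.1, VII.3.1(b), VII.6.1 [SilvermanAEC2009]; Kramer–Tunnell, Compositio 46 (1982) §6 Lemma 6.1
(the odd-`c` list, for comparison only) [KramerTunnell1982].
-/

noncomputable section

open scoped Classical AddSubgroup

open NumberField WeierstrassCurve Literature.NumberTheory.EllipticCurves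
  Literature.NumberTheory.EllipticCurves.Rank1Residual
  Summit.BirchSwinnertonDyer.Rank1Residual
  Summit.BirchSwinnertonDyer.Rank1Residual.O5.GoodReductionThree
  Summit.BirchSwinnertonDyer.Rank1Residual.X11b.LocalTorsion

namespace Summit.BirchSwinnertonDyer.Uniform.U2

/-! ## §1 `E(ℚ_ℓ)[2] = 0 ⟺ c_ℓ · #Ẽ_ns(𝔽_ℓ)` odd, at every odd prime -/

section Criterion

variable (W : WeierstrassCurve ℚ) [W.IsElliptic] [W.IsGloballyMinimal] (ℓ : ℕ) [Fact ℓ.Prime]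

/-- **`E(ℚ_ℓ)[2] = 0 ⟺ [E(ℚ_ℓ) : E₁(ℚ_ℓ)]` is odd**, for a globally minimal elliptic `W/ℚ` and a
prime `ℓ ≠ 2` of ANY reduction type: `E(ℚ_ℓ)[2] ≅ (E(ℚ_ℓ)/E₁(ℚ_ℓ))[2]` (the kernel of reduction is
uniquely `2`-divisible for `ℓ ∤ 2`), and a finite abelian group has no element of order `2` iff its
order — here `formalIndex W ℓ = [E(ℚ_ℓ) : E₁(ℚ_ℓ)]` — is odd.
[cite: SilvermanAEC2009, Prop. VII.3.1(b) with IV.2.3 and VII.2.1] -/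
theorem forall_two_nsmul_eq_zero_iff_odd_formalIndex (hℓ2 : ℓ ≠ 2) :
    (∀ Q : (W.baseChange ℚ_[ℓ]).toAffine.Point, 2 • Q = 0 → Q = 0) ↔ Odd (formalIndex W ℓ) := by
  haveI : (W.baseChange ℚ_[ℓ]).IsMinimal ℤ_[ℓ] := isMinimal_map_padic_of_isGloballyMinimal W ℓ
  haveI : ((W.baseChange ℚ_[ℓ]).formalFiltration 1).FiniteIndex :=
    (W.baseChange ℚ_[ℓ]).finiteIndex_formalFiltration 1
  have hℓ : ℓ.Prime := Fact.out
  have hn : ¬ ℓ ∣ 2 := fun h => hℓ2 ((Nat.prime_dvd_prime_iff_eq hℓ Nat.prime_two).mp h)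
  rw [(W.baseChange ℚ_[ℓ]).forall_nsmul_eq_zero_iff_quotient_formalFiltration hn,
    forall_two_nsmul_eq_zero_iff_odd_card, ← AddSubgroup.index_eq_card]
  rfl

/-- **THE DECIDABLE FORM: `E(ℚ_ℓ)[2] = 0 ⟺ c_ℓ(E)` odd `∧ frobeniusTrace W ℓ` odd** (`ℓ ≠ 2`, any
reduction type; `c_ℓ = [E(ℚ_ℓ) : E₀(ℚ_ℓ)]` the local Tamagawa number of `W/ℚ_ℓ`,
`frobeniusTrace W ℓ = ℓ + 1 − #Ẽ_ns(𝔽_ℓ)` the tree's trace — `a_ℓ(E)` at a good prime, `1` at an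
additive prime, `2`/`0` at a split/non-split multiplicative prime): `[E(ℚ_ℓ) : E₁(ℚ_ℓ)] =
c_ℓ · #Ẽ_ns(𝔽_ℓ)` (tree `formalIndex_eq_tamagawa_mul_reductionPointCount`) and, `ℓ` being odd,
`#Ẽ_ns(𝔽_ℓ)` is odd iff `frobeniusTrace W ℓ` is. [cite: SilvermanAEC2009, Prop. VII.3.1(b), VII.2.1 and Thm. VII.6.1] -/
theorem forall_two_nsmul_eq_zero_iff_odd_tamagawa_and_odd_frobeniusTrace (hℓ2 : ℓ ≠ 2) :
    (∀ Q : (W.baseChange ℚ_[ℓ]).toAffine.Point, 2 • Q = 0 → Q = 0) ↔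
      Odd ((W.baseChange ℚ_[ℓ]).localTamagawaNumber ℤ_[ℓ]) ∧ Odd (W.frobeniusTrace ℓ) := by
  haveI : (W.baseChange ℚ_[ℓ]).IsMinimal ℤ_[ℓ] := isMinimal_map_padic_of_isGloballyMinimal W ℓ
  rw [forall_two_nsmul_eq_zero_iff_odd_formalIndex W ℓ hℓ2,
    formalIndex_eq_tamagawa_mul_reductionPointCount W ℓ, Nat.odd_mul,
    odd_frobeniusTrace_iff_odd_reductionPointCount W Fact.out hℓ2]

/-- **At a MULTIPLICATIVE odd prime `E(ℚ_ℓ)[2] ≠ 0`**: `#Ẽ_ns(𝔽_ℓ) = ℓ − 1` (split) or `ℓ + 1`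
(non-split) is even, so the tree's `frobeniusTrace W ℓ ∈ {2, 0}` is even (tree
`reductionPointCount_of_mult`). Hence Lemma 2.10 (ii) never applies at such `ℓ` (residue R-A2 is
untouched by the place-wise form). [cite: SilvermanAEC2009, Exercise 3.5 and Prop. VII.3.1(b)] -/
theorem not_forall_two_nsmul_eq_zero_of_mult (hℓ2 : ℓ ≠ 2) (hmult : Mult W ℓ) :
    ¬ ∀ Q : (W.baseChange ℚ_[ℓ]).toAffine.Point, 2 • Q = 0 → Q = 0 := by
  rw [forall_two_nsmul_eq_zero_iff_odd_tamagawa_and_odd_frobeniusTrace W ℓ hℓ2]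
  rintro ⟨-, hodd⟩
  have hℓ : ℓ.Prime := Fact.out
  have hℓodd : Odd ℓ := hℓ.odd_of_ne_two hℓ2
  obtain ⟨hs, hns⟩ := reductionPointCount_of_mult W ℓ hmult
  unfold WeierstrassCurve.frobeniusTrace at hodd
  by_cases hsplit : W.HasSplitMultiplicativeReductionAtPrime ℓ
  · have h := hs hsplit
    have : W.frobeniusTrace ℓ = 2 := by
      unfold WeierstrassCurve.frobeniusTrace; omega
    rw [WeierstrassCurve.frobeniusTrace] at this
    rw [this] at hodd
    exact (Int.not_odd_iff_even.mpr (by decide)) hodd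
  · have h := hns hsplit
    have : W.frobeniusTrace ℓ = 0 := by
      unfold WeierstrassCurve.frobeniusTrace; omega
    rw [WeierstrassCurve.frobeniusTrace] at this
    rw [this] at hodd
    exact (Int.not_odd_iff_even.mpr (by decide)) hodd

end Criterion

/-! ## §2 Route A, place-wise, on the `a_q`-odd class, with disjunct (ii) in decidable form -/

section Dec

variable (W : WeierstrassCurve ℚ) [W.IsElliptic] [W.IsGloballyMinimal]

/-- **ROUTE A, PLACE-WISE, ON THE `a_q`-ODD CLASS — disjunct (ii) DECIDED.** As
`routeA_placewise_oddTrace`, with the disjunct «`p` odd and `E(ℚ_p)[2] = 0`» at a bad prime `p`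
replaced by its decidable form «`p` odd, `c_p(E)` odd, `frobeniusTrace W p` odd» (at an additive
`p` the last conjunct is automatic, `frobeniusTrace = 1`; at a multiplicative `p` the disjunct is
void). Binders: `W` globally minimal; `d ≡ 1 (mod 4)` square-free, `≠ 1`; every prime `q ∣ d` good
with `a_q` odd; at every BAD prime `p`: `p` splits in `ℚ(√d)` ∨ (`p` odd ∧ `c_p` odd ∧
`frobeniusTrace W p` odd) ∨ (multiplicative ∧ `ord_p Δ` odd); `d > 0 ∨ Δ < 0`; base data
`E(ℚ)[2] = 0`, `Ш(E)[2] = 0`, `rank E ≤ 1`; finiteness of `Ш(E^{(d)})[2^∞]`; named facts `hMR`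
(place-wise Mazur–Rubin) and `hCT` (Cassels–Tate). Conclusion: `rank E^{(d)} = rank E` and
`Ш(E^{(d)})[2^∞] = 0`. [cite: MazurRubin2010, Lemma 2.10 (i)–(v) with Def. 2.3 and the proof of Prop. 3.3 (T = ∅)]
[cite: SilvermanAEC2009, Prop. VII.3.1(b), VII.2.1 and Thm. VII.6.1] -/
theorem routeA_placewise_oddTrace_dec (hMR : MazurRubin2010.d2_eq_of_lemma210_rat)
    (hCT : exists_casselsTate_pairing (K := ℚ))
    {d : ℤ} (hd : Squarefree d) (hd1 : d ≠ 1) (hd4 : d % 4 = 1)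
    (hS : ∀ (q : ℕ), q.Prime → (q : ℤ) ∣ d →
      ¬ (q : ℤ) ∣ minimalDiscriminantInt W ∧ Odd (W.frobeniusTrace q))
    (hbad : ∀ (p : ℕ) [Fact p.Prime], (p : ℤ) ∣ minimalDiscriminantInt W →
      ((p = 2 ∧ d % 8 = 1) ∨ (p ≠ 2 ∧ jacobiSym d p = 1)) ∨
      (p ≠ 2 ∧ Odd ((W.baseChange ℚ_[p]).localTamagawaNumber ℤ_[p]) ∧ Odd (W.frobeniusTrace p)) ∨
      (W.HasMultiplicativeReductionAtPrime p ∧ Odd (padicValRat p W.Δ)))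
    (hreal : 0 < d ∨ W.Δ < 0)
    (hW2 : W.toAffine.Point[(2 : ℤ)] = ⊥) (hWsha : (W.sha)[(2 : ℤ)] = ⊥) (hWr : W.mordellWeilRank ≤ 1)
    (W' : WeierstrassCurve ℚ) [W'.IsElliptic]
    (htw : ∃ C : VariableChange ℚ, C • W' = W.quadraticTwist (d : ℚ))
    (hfin : Finite (AddCommGroup.primaryComponent W'.sha 2)) :
    W'.mordellWeilRank = W.mordellWeilRank ∧ AddCommGroup.primaryComponent W'.sha 2 = ⊥ := by
  refine routeA_placewise_oddTrace W hMR hCT hd hd1 hd4 hS (fun p _ hp => ?_) hreal hW2 hWsha hWr W'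
    htw hfin
  rcases hbad p hp with h | ⟨hp2, hc, ha⟩ | h
  · exact Or.inl h
  · exact Or.inr (Or.inl ⟨hp2,
      (forall_two_nsmul_eq_zero_iff_odd_tamagawa_and_odd_frobeniusTrace W p hp2).mpr ⟨hc, ha⟩⟩)
  · exact Or.inr (Or.inr h)

end Dec

end Summit.BirchSwinnertonDyer.Uniform.U2

end
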